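import Literature.Probability.Percolation.HalfPlaneTwoArmPointLower
import HarnessLib

/-!
# An open and a closed arm from the real line give a good (or anti-good) point between them

Topic `Literature/Probability/Percolation`; family `crit-perc`, statement **crit-perc.S16**
(`Literature.Probability.Percolation.triTheta_exponent`). The last deterministic step of the
"inner separation via good points" bound for the half-plane two-arm probability at two radii
(Kesten 1987, Lemma 4 / (2.41)–(2.42); W. Werner, *Lectures on two-dimensional critical
percolation* (2009), Lecture 2, first exercise sheet, "Two-arm exponent in the half-plane", 2b:
"each good point is the right-most point of the intersection of its cluster with the real
line"): if inside the half-box `S⁺_M` an open path joins a real point `x_o` of the window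
`[-L, L] × {0}` to the outer boundary `∂⁺S⁺_M` and a closed path joins another real point `x_c`
of the window to `∂⁺S⁺_M`, then some point `(x₀, 0)` of the window is **good** for `ω`
(`hpGood M`, `HalfPlaneTwoArmPoint.lean`) — when `x_o` is left of `x_c`: the right-most real
point of the open cluster of `x_o`, which lies left of `x_c` by the interlacing lemma — or good for
`ωᶜ` (when `x_c` is left of `x_o`, by colour exchange).

* `hpGood_of_open_left_of_closed` — the case `x_o < x_c`.
* `exists_hpGood_or_compl` — the symmetric statement.

## References

* W. Werner, Lectures on two-dimensional critical percolation, IAS/Park City Math. Ser. 16 (2009),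
  Lecture 2, first exercise sheet [WernerPCMI2009].
* H. Kesten, Scaling relations for 2D-percolation, *Comm. Math. Phys.* 109 (1987), Lemma 4
  [KestenScalingCMP1987].

## Mathlib / tree

Tree: `hpGood_of_rightmost` (`HalfPlaneTwoArmPointLower.lean`), `interlace`, `hpBox`, `mem_hpBox`,
`hpOuter`, `mem_hpOuter`, `site_eq_vec`, `triGraph_adj_right` (`HalfPlaneTwoArmPoint.lean`).
Mathlib: `Finset.max'`.
-/

noncomputable section

open Set

namespace Literature.Probability.Percolation

open LatticeModels

variable {M : ℕ} {ω : SiteConfig (Site 2)}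

/-- **Open arm left of a closed arm ⇒ a good point in between.** If an open path of `S⁺_M` joins
the real point `x_o` to `∂⁺S⁺_M`, a closed one joins the real point `x_c` to `∂⁺S⁺_M`, and
`-L ≤ (x_o)₀ < (x_c)₀ ≤ L` with `L + 1 < M`, then the right-most real point `(x⋆, 0)`,
`x⋆ ≤ 2M`, of the open cluster of `x_o` in `S⁺_M` satisfies `(x_o)₀ ≤ x⋆ < (x_c)₀` (interlacing)
and is `M`-good. [cite: WernerPCMI2009, Lecture 2, first exercise sheet ("Two-arm exponent in the half-plane", 1b–2b)] [cite: KestenPTM1982, §2.2 (paths crossing a rectangle must intersect)] -/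
theorem hpGood_of_open_left_of_closed {L : ℤ} (hL : L + 1 < M) {xo xc : Site 2} (hxo1 : xo 1 = 0)
    (hxc1 : xc 1 = 0) (hlt : xo 0 < xc 0) (hxo : -L ≤ xo 0) (hxc : xc 0 ≤ L)
    {t₁ tc : Site 2} (hto : t₁ ∈ hpOuter M) (htc : tc ∈ hpOuter M)
    (hpo : PathIn triGraph (hpBox M ∩ ω) xo t₁) (hpc : PathIn triGraph (hpBox M ∩ ωᶜ) xc tc) :
    ∃ x₀ : ℤ, -L ≤ x₀ ∧ x₀ ≤ L ∧ ω ∈ hpGood M ![x₀, 0] := by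
  classical
  have hM : (0 : ℤ) ≤ M := by positivity
  set a : ℤ := xo 0 with ha
  set b : ℤ := xc 0 with hb
  have hxoe : xo = ![a, 0] := by rw [site_eq_vec xo, hxo1]
  have hxce : xc = ![b, 0] := by rw [site_eq_vec xc, hxc1]
  rw [hxoe] at hpo
  rw [hxce] at hpc
  -- the real points of the open cluster of `x_o`, and the right-most one
  set R : Finset ℤ := (Finset.Icc a (2 * M)).filter fun r =>
    PathIn triGraph (hpBox M ∩ ω) ![a, 0] ![r, 0] with hR
  have haR : a ∈ R := by
    rw [hR, Finset.mem_filter, Finset.mem_Icc]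
    exact ⟨⟨le_rfl, by omega⟩, PathIn.refl hpo.left_mem⟩
  set c : ℤ := R.max' ⟨a, haR⟩ with hc
  have hcR : c ∈ R := Finset.max'_mem R ⟨a, haR⟩
  have hle : ∀ r ∈ R, r ≤ c := fun r hr => Finset.le_max' R r hr
  obtain ⟨hcI, hpath⟩ := Finset.mem_filter.1 hcR
  rw [Finset.mem_Icc] at hcI
  -- the right-most point lies left of `x_c`
  have hcb : c < b := by
    by_contra hge
    push Not at hge
    have hne : c ≠ b := by
      intro heq
      have h1 : (![c, 0] : Site 2) ∈ ω := hpath.right_mem.2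
      have h2 : (![b, 0] : Site 2) ∉ ω := hpc.left_mem.2
      rw [heq] at h1
      exact h2 h1
    have hbc : b < c := lt_of_le_of_ne hge (Ne.symm hne)
    -- pad the closed path one step beyond the lateral sides of the half-box
    set Pad : Set (Site 2) := {z | (z 0 = 2 * M + 1 ∨ z 0 = -(2 * (M : ℤ)) - 1) ∧ 0 ≤ z 1 ∧ z 1 ≤ 2 * M}
      with hPad
    have htcb := (mem_hpBox.1 hpc.right_mem.1)
    have hβ : ∃ t : Site 2, (t 0 = -(2 * (M : ℤ) + 1) ∨ t 0 = 2 * M + 1 ∨ t 1 = 2 * M) ∧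
        PathIn triGraph ((hpBox M ∩ ωᶜ) ∪ Pad) ![b, 0] t := by
      have hpc' : PathIn triGraph ((hpBox M ∩ ωᶜ) ∪ Pad) ![b, 0] tc := hpc.mono subset_union_left
      rcases mem_hpOuter.1 htc with h | h | h
      · refine ⟨![tc 0 - 1, tc 1], Or.inl (by simp [h]; ring), hpc'.tail ?_ (Or.inr ⟨Or.inr ?_, ?_, ?_⟩)⟩
        · have hadj := triGraph_adj_right (tc 0 - 1) (tc 1)
          rw [sub_add_cancel, ← site_eq_vec tc] at hadj
          exact hadj.symm
        · simp [h]
        · simp; omega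
        · simp; omega
      · refine ⟨![tc 0 + 1, tc 1], Or.inr (Or.inl (by simp [h])), hpc'.tail ?_ (Or.inr ⟨Or.inl ?_, ?_, ?_⟩)⟩
        · have hadj := triGraph_adj_right (tc 0) (tc 1)
          rw [← site_eq_vec tc] at hadj
          exact hadj
        · simp [h]
        · simp; omega
        · simp; omega
      · exact ⟨tc, Or.inr (Or.inr h), hpc'⟩
    obtain ⟨t, ht, hβ⟩ := hβ
    obtain ⟨z, hzA, hzA'⟩ := interlace (K := 2 * (M : ℤ) + 1) (T := 2 * M) (by omega)
      (A := hpBox M ∩ ω) (A' := (hpBox M ∩ ωᶜ) ∪ Pad)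
      (fun z hz => by have := mem_hpBox.1 hz.1; omega)
      (by
        rintro z (hz | hz)
        · have := mem_hpBox.1 hz.1; omega
        · have := hz.1; have := hz.2; omega)
      hlt hbc (by omega) (by omega) hpath (t := t) (by rcases ht with h | h | h <;> omega) hβ
    rcases hzA' with hz | hz
    · exact hz.2 hzA.2
    · have h1 := mem_hpBox.1 hzA.1
      have h2 := hz.1
      omega
  -- maximality and the open arm of the right-most point
  have hmax : ∀ r : ℤ, c < r → r ≤ 2 * M → ¬ PathIn triGraph (hpBox M ∩ ω) ![c, 0] ![r, 0] := by
    intro r hcr hr hp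
    have hrR : r ∈ R := by
      rw [hR, Finset.mem_filter, Finset.mem_Icc]
      exact ⟨⟨by omega, hr⟩, hpath.trans hp⟩
    exact absurd (hle r hrR) (not_le.2 hcr)
  have hopen : PathIn triGraph (hpBox M ∩ ω) ![c, 0] t₁ := hpath.symm.trans hpo
  exact ⟨c, by omega, by omega, hpGood_of_rightmost (by omega) (by omega) hto hopen hmax⟩

/-- **An open and a closed arm from the window give a good or an anti-good point.** If inside
`S⁺_M` an open path joins a real point `x_o` of the window `[-L, L] × {0}` to `∂⁺S⁺_M` and a
closed path joins a real point `x_c` of the window to `∂⁺S⁺_M` (`L + 1 < M`), then some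
`(x₀, 0)` with `-L ≤ x₀ ≤ L` is `M`-good for `ω` or for `ωᶜ`. [cite: WernerPCMI2009, Lecture 2, first exercise sheet ("Two-arm exponent in the half-plane", 2b)] [cite: KestenScalingCMP1987, Lemma 4] -/
theorem exists_hpGood_or_compl {L : ℤ} (hL : L + 1 < M) {xo xc : Site 2} (hxo1 : xo 1 = 0)
    (hxc1 : xc 1 = 0) (hxo : -L ≤ xo 0) (hxo' : xo 0 ≤ L) (hxc : -L ≤ xc 0) (hxc' : xc 0 ≤ L)
    {t₁ tc : Site 2} (hto : t₁ ∈ hpOuter M) (htc : tc ∈ hpOuter M)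
    (hpo : PathIn triGraph (hpBox M ∩ ω) xo t₁) (hpc : PathIn triGraph (hpBox M ∩ ωᶜ) xc tc) :
    ∃ x₀ : ℤ, -L ≤ x₀ ∧ x₀ ≤ L ∧ (ω ∈ hpGood M ![x₀, 0] ∨ ωᶜ ∈ hpGood M ![x₀, 0]) := by
  rcases lt_trichotomy (xo 0) (xc 0) with h | h | h
  · obtain ⟨x₀, h1, h2, h3⟩ := hpGood_of_open_left_of_closed hL hxo1 hxc1 h hxo hxc' hto htc hpo hpc
    exact ⟨x₀, h1, h2, Or.inl h3⟩
  · exfalso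
    have : xo = xc := by rw [site_eq_vec xo, site_eq_vec xc, h, hxo1, hxc1]
    rw [this] at hpo
    exact hpc.left_mem.2 hpo.left_mem.2
  · have hpo' : PathIn triGraph (hpBox M ∩ ωᶜᶜ) xo t₁ := by rw [compl_compl]; exact hpo
    obtain ⟨x₀, h1, h2, h3⟩ := hpGood_of_open_left_of_closed (ω := ωᶜ) hL hxc1 hxo1 h hxc hxo' htc hto hpc hpo'
    exact ⟨x₀, h1, h2, Or.inr h3⟩

end Literature.Probability.Percolation
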